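import Summits.BirchSwinnertonDyer.BirchSwinnertonDyer.Theorems.ErratumRoadFiveNonSurjCornerTwinKato
import Summits.BirchSwinnertonDyer.BirchSwinnertonDyer.Theorems.ErratumRoadFiveNonSurjCornerKolyJTamZero
import HarnessLib

/-!
# Route `ErratumRoadFive` (rung K2), crux `NonSurjCorner` (item stmt-BirchSwinnertonDyer-19065): THE HYBRID CUT BY CARRIER PROFILE —
# the route decl `NonSurjCorner` from {Zₚᶜ (child 19946), the MAX form of Jₚᶜ (19947's `stub_kolyJ_max`, landed modulo three named facts),
# an UPPER-HALF input on MULTI-carrier pairs (the inert Shimura road), the twins' typed divisibility, `X11aLowerHalf`} — NO SUM FORM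
# (cell `bsd-stepL`, seat `bsd-stepL-corner-p1` g12; `--supports stmt-BirchSwinnertonDyer-19065 --as helper`)

WHY THIS FILE. The registered decomposition of crux 19065 (children 19946 KolyZ, 19947 KolyJ, 19948 TwinMuAn, glue 19951) routes the
corner's UPPER half through 19947 = the Jetchev direction in SUM form, whose multi-carrier part `stub_kolyJ_multi` is beyond every
Kolyvagin-system argument (Jetchev's walk is memoryless across carriers — CORNER-G12 §1; the sum is BCGS Thm. 2 via the IMC). But the
sum form is needed ONLY on multi-carrier pairs, and those are exactly where the INERT Shimura road applies without any Tamagawa sum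
(both carriers inert: `S = {p, q}`; this seat's p576831 ∕ p577927 ∕ p578284 and the display p577928): census at `p = 5` below 5·10⁵ —
mono 37 (MAX form), multi 3 (all inert-admissible). This file is the GLUE of that hybrid, pointwise in the pair, as a theorem concluding
the ROUTE decl: `erratumRoadFive_nonSurjCorner_of_kolyZ_of_kolyJMax_of_multiUpper_of_lowerX11a_of_twinMultDivisibility`. Its inputs:
Zₚᶜ (19946's text), `stub_kolyJ_max` (19947's registered stub, VERBATIM), `hUmulti` (upper half on multi-carrier corner pairs — a
hypothesis SHAPE, served by the inert road on admissible pairs), the twins' typed divisibility (19948's object via x11c), `X11aLowerHalf`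
(19064), and road 2's named facts. With it the planner can re-line 19065 as {19946, 19947-MAX, inert-multi, 19948, 19064} — the p ≥ 5
twin of 19111's line of record — and `stub_kolyJ_multi` leaves the cone (replaced by inert admissibility of multi-carrier pairs, a
decidable datum per pair, plus the inert road's named inputs).

HONEST FRAMING: THEOREMS ONLY (no definition, no named fact, no `sorry`); CONDITIONAL on every displayed binder; item 19065 is NOT
closed, no stub is discharged; nothing about any curve's BSD; BSD is not advanced; T7. Credit: this seat g0–g6 (roads 1 ∕ 2 and their
per-pair lemmas), x11c (typed divisibility), lane B ∕ shim (the inert machinery behind `hUmulti`).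
References (locators only): [cite: Cha2005, Rmk. 25] [cite: MatarNekovar2019, §0.11] [cite: Jetchev2008, Thm. 1.4, §6] [cite: WZhang2014, Thm. 1.1]
[cite: JetchevSkinnerWan2017, §7.4] [cite: Miller2011LMS, Def. 1.1].
-/

set_option autoImplicit false
set_option linter.dupNamespace false -- `Summit.BirchSwinnertonDyer.BirchSwinnertonDyer` (summit = problem), tree-wide

noncomputable section

open scoped Classical NumberField MatrixGroups ModularForm

namespace Summit.BirchSwinnertonDyer.Rank1Residual.X11b

open CongruenceSubgroup WeierstrassCurve NumberField IsDedekindDomain Field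
  Literature.NumberTheory.EllipticCurves
  Literature.NumberTheory.EllipticCurves.ModularForms
  Literature.NumberTheory.EllipticCurves.Rank1Residual
  Literature.NumberTheory.EllipticCurves.Rank1Residual.Typed
  Literature.NumberTheory.EllipticCurves.Wuthrich2014
  Literature.NumberTheory.EllipticCurves.SteinWuthrich2013
  Literature.NumberTheory.EllipticCurves.GreenbergVatsal2000
  Literature.NumberTheory.EllipticCurves.EmertonPollackWeston2006
  Literature.NumberTheory.QuadraticFields.Quadratic
  Summit.BirchSwinnertonDyer.Rank1Residual
  Summit.BirchSwinnertonDyer.Rank1Residual.RankZeroHeightFree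
  Summit.BirchSwinnertonDyer.Rank1Residual.X11b.Three.Koly

/-- **THE HYBRID CUT OF CRUX 19065 BY CARRIER PROFILE — `NonSurjCorner` WITHOUT THE SUM FORM.** Road 2 of this file's ancestry
(`erratumRoadFive_nonSurjCorner_of_refinedKolyvagin_of_lowerX11a_of_twinMultDivisibility`, p454452 ∕ p478491: Zₚᶜ + Jₚᶜ + twin
inputs + `X11aLowerHalf`) with its Jₚᶜ binder (the SUM form = child 19947 whole, whose multi-carrier part `stub_kolyJ_multi` is
IMC-grade — memo CORNER-G12 §1) REPLACED by TWO inputs cut by the carrier profile of the pair: `hJmax` = the MAX form = 19947's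
registered `stub_kolyJ_max` VERBATIM (landed modulo {Gross 3.7 (2), Poitou–Tate, GZ III (3.1)}: `Koly.nonSurjCornerKolyJ_max_of_threeNamedFacts`,
p573171), used on the pairs with `p ∤ ∏c` (there `Theorems.nonSurjCornerKolyJ_of_not_dvd_tamagawa`, p490656) or with ONE place carrying
the whole `p`-part of `∏c`; and `hUmulti` = the UPPER half `Typed.MissingUpperBoundAt W p` on the MULTI-carrier corner pairs from ANY
other road — this seat's inert Shimura road supplies it on inert-admissible pairs (`NonSurjCorner.missingUpperBoundAt_of_inertSetDatum_of_primitives`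
∕ `…_of_secondPrime_of_primitives`; all 3 multi-carrier pairs at `p = 5` below 5·10⁵ are admissible, CORNER-G12 §5). Proof = road 2's,
pointwise in `(W, p)`: upper half by cases on the carrier profile (mono: g4's `missingUpperBoundAt_corner_of_jetchevDivisibility_of_twinLeafLower`
with the full-depth divisibility AT `W` obtained from the MAX form at the carrier; multi: `hUmulti`); lower half unchanged (g0 ∕ g2:
certificates Zₚᶜ + the twin's Euler-system half from the typed divisibility). CONDITIONAL on `h₄`, `hZ`, `hJmax`, `hUmulti`, `hdiv` and
the named facts; does NOT close item 19065; nothing booked; T7. [cite: Cha2005, Thm. 21 and Rmk. 25 (pp. 173–175)]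
[cite: MatarNekovar2019, Thm. 0.7, §0.9, §0.11] [cite: Jetchev2008, Thm. 1.4, §6 Thm. 6.3] [cite: WZhang2014, Thm. 1.1 (shape of Zₚᶜ)]
[cite: JetchevSkinnerWan2017, §7.4.1–7.4.2] [cite: Miller2011LMS, Def. 1.1] -/
theorem erratumRoadFive_nonSurjCorner_of_kolyZ_of_kolyJMax_of_multiUpper_of_lowerX11a_of_twinMultDivisibility
    (hGZ : ∀ (N : ℕ) [NeZero N] (W : WeierstrassCurve ℚ) (K : Type) [Field K] [NumberField K],
      gross_zagier N W K)
    (hKo : ∀ (N : ℕ) [NeZero N] (W : WeierstrassCurve ℚ) (K : Type) [Field K] [NumberField K],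
      kolyvagin N W K)
    (hWu : sha_dvd_analyticSha)
    (hGZK : rank_eq_analyticRank_of_analyticRank_le_one) (hmod : hasEntireLFunction_rat)
    (hnf : exists_isNewformOf) (hpar : nonempty_modularParametrizationData)
    (hFHs : friedbergHoffstein_exists_heegnerField_split_twist_ne_zero)
    (hMaz : mazur_not_dvd_maninConstant_of_odd)
    (hrec : ∀ (N : ℕ) [NeZero N] (W : WeierstrassCurve ℚ) (K : Type) [Field K] [NumberField K],
      heegnerPointOfConductor_one_galoisConj N W K)
    (hD36 : ∀ (N : ℕ) [NeZero N] (W : WeierstrassCurve ℚ) (K : Type) [Field K] [NumberField K],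
      phi_heegnerTau_mem_singularModuliField N W K)
    (hJs : thm61_splitMultiplicative) (hJn : thm61_nonsplitMultiplicative)
    (hGS : ∀ (W : WeierstrassCurve ℚ) [W.IsElliptic] [W.IsGloballyMinimal] (p : ℕ) [Fact p.Prime],
      greenberg_stevens (W := W) (p := p))
    (hChaL : Cha2005.rmk25_pow_dvd_card_sha_primary_of_certificate)
    (hChaU : Cha2005.rmk25_padicValNat_card_sha_primary_add_le_of_globalDivisibility)
    (h₄ : Summit.BirchSwinnertonDyer.BirchSwinnertonDyer.Theses.ErratumRoadFive.X11aLowerHalf)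
    -- Zₚᶜ: certificates on corner frames (`M_∞ ≤ t`)
    (hZ : ∀ (W : WeierstrassCurve ℚ) [W.IsElliptic] [W.IsGloballyMinimal] (p : ℕ) [Fact p.Prime]
      (N : ℕ) [NeZero N] (K : Type) [Field K] [NumberField K]
      (Dt : ModularParametrizationData W N) (β : ℤ) (ι : K →+* ℂ),
      ClassX11b W p → ¬ Surj W p → (p = 5 ∨ p = 7) → p ∣ padicValInt p W.minimalDiscriminantInt →
      ¬ Ram W p → W.conductorNorm ℤ = N → IsImaginaryQuadratic K →
      4 < (NumberField.discr K).natAbs → SatisfiesHeegnerHypothesis N K →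
      SatisfiesHeegnerHypothesis p K → (4 * (N : ℤ)) ∣ β ^ 2 - NumberField.discr K → ¬ (p : ℤ) ∣ Dt.c →
      ∃ M : ℕ, M ≤ padicValNat p W.tamagawaProduct ∧ CertificateAt Dt β ι p M)
    -- Jₚ-MAX: the Jetchev direction in MAX form on corner frames (19947's `stub_kolyJ_max` VERBATIM; ⟸ {(A′), PT, GZ III (3.1)}, p573171)
    (hJmax : ∀ (W : WeierstrassCurve ℚ) [W.IsElliptic] [W.IsGloballyMinimal] [NeZero (W.conductorNorm ℤ)]
      (p : ℕ) [Fact p.Prime] (K : Type) [Field K] [NumberField K]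
      (Dt : ModularParametrizationData W (W.conductorNorm ℤ)) (β : ℤ) (ι : K →+* ℂ),
      p ∣ W.tamagawaProduct →
      ClassX11b W p → ¬ Surj W p → (p = 5 ∨ p = 7) → p ∣ padicValInt p W.minimalDiscriminantInt →
      ¬ Ram W p → IsImaginaryQuadratic K → 4 < (NumberField.discr K).natAbs →
      SatisfiesHeegnerHypothesis (W.conductorNorm ℤ) K → SatisfiesHeegnerHypothesis p K →
      (4 * (W.conductorNorm ℤ : ℤ)) ∣ β ^ 2 - NumberField.discr K → ¬ (p : ℤ) ∣ Dt.c →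
      ∀ (v : HeightOneSpectrum (𝓞 ℚ)) (s : ℕ), s ≤ padicValNat p (W.tamagawaNumberAt v) →
        ∀ (n : ℕ) (d : KolyvaginHeegnerData Dt β ι n), Squarefree n →
          (∀ ℓ ∈ n.primeFactors, Zhang2014.IsKolyvaginPrime (W.conductorNorm ℤ) W K p ℓ ∧
            s ≤ Zhang2014.kolyvaginIndex W p ℓ) → PDiv d p s)
    -- the UPPER half on the MULTI-carrier corner pairs from another road (the inert Shimura road: this seat's
    -- `NonSurjCorner.missingUpperBoundAt_of_inertSetDatum_of_primitives` on an inert-admissible pair)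
    (hUmulti : ∀ (W : WeierstrassCurve ℚ) [W.IsElliptic] [W.IsGloballyMinimal] (p : ℕ) [Fact p.Prime],
      ClassX11b W p → ¬ Surj W p → (p = 5 ∨ p = 7) → p ∣ padicValInt p W.minimalDiscriminantInt →
      ¬ Ram W p → p ∣ W.tamagawaProduct →
      (∀ v : HeightOneSpectrum (𝓞 ℚ), padicValNat p (W.tamagawaNumberAt v) < padicValNat p W.tamagawaProduct) →
      Typed.MissingUpperBoundAt W p)
    -- the typed divisibility on the NON-SURJECTIVE X11a leaf at p ∈ {5,7} (x11c's missing input, by name)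
    (hdiv : ∀ (Wd : WeierstrassCurve ℚ) [Wd.IsElliptic] [Wd.IsGloballyMinimal] (p : ℕ) [Fact p.Prime],
      ClassX11a Wd p → ¬ Surj Wd p → (p = 5 ∨ p = 7) →
      p ∣ padicValInt p Wd.minimalDiscriminantInt → MultDivisibilityAt Wd p) :
    Summit.BirchSwinnertonDyer.BirchSwinnertonDyer.Theses.ErratumRoadFive.NonSurjCorner := by
  intro W _ _ p _ hX hns h57 hv hnr
  have hp5 : 5 ≤ p := by rcases h57 with h | h <;> omega
  -- the Euler-system half of every non-surjective-leaf twin at this p, from the typed divisibility (§1)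
  have hleafU : ∀ (Wd : WeierstrassCurve ℚ) [Wd.IsElliptic] [Wd.IsGloballyMinimal],
      ClassX11a Wd p → ¬ Surj Wd p → p ∣ padicValInt p Wd.minimalDiscriminantInt →
      Typed.MissingUpperBoundAt Wd p := fun Wd _ _ hXa hnsd hvd ↦
    missingUpperBoundAt_of_classX11a_of_multDivisibilityAt hJs hJn hGZK hmod hpar Wd p (hGS Wd p) hXa
      (hdiv Wd p hXa hnsd h57 hvd)
  haveI : NeZero (W.conductorNorm ℤ) := ⟨(W.conductorNorm_pos_holds).ne'⟩
  -- the UPPER half, by CARRIER PROFILE: t = 0 or MONO-carrier ← the X₀(N) MAX form; MULTI-carrier ← the other road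
  have hupper : Typed.MissingUpperBoundAt W p := by
    by_cases hcase : ¬ p ∣ W.tamagawaProduct ∨
        ∃ v : HeightOneSpectrum (𝓞 ℚ), padicValNat p W.tamagawaProduct ≤ padicValNat p (W.tamagawaNumberAt v)
    · refine missingUpperBoundAt_corner_of_jetchevDivisibility_of_twinLeafLower hGZ hKo hGZK hmod hnf hFHs hMaz
        hrec hD36 hChaU W p hX hns h57 hv hnr (fun Wd _ _ hXa _ _ ↦ h₄ Wd p hXa) ?_
      intro _ K _ _ Dt β ι hK hdisc hHN hHp hβ hc s hs n d hn hℓ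
      rcases hcase with htam | ⟨v, hvt⟩
      · exact Summit.BirchSwinnertonDyer.BirchSwinnertonDyer.Theorems.nonSurjCornerKolyJ_of_not_dvd_tamagawa W p K
          Dt β ι htam hX hns h57 hv hnr hK hdisc hHN hHp hβ hc s hs n d hn hℓ
      · by_cases htam : p ∣ W.tamagawaProduct
        · exact hJmax W p K Dt β ι htam hX hns h57 hv hnr hK hdisc hHN hHp hβ hc v s (hs.trans hvt) n d hn hℓ
        · exact Summit.BirchSwinnertonDyer.BirchSwinnertonDyer.Theorems.nonSurjCornerKolyJ_of_not_dvd_tamagawa W p K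
            Dt β ι htam hX hns h57 hv hnr hK hdisc hHN hHp hβ hc s hs n d hn hℓ
    · push Not at hcase
      exact hUmulti W p hX hns h57 hv hnr hcase.1 hcase.2
  refine Typed.missingPPartAt_of_lower_of_upper W p ?_ hupper
  refine missingLowerBoundAt_of_classX11b_of_indexLowerBoundNoSurj_of_upperTwist hGZ hKo hWu hGZK
    hmod hnf hFHs hMaz W p hX hp5
    (fun N _ K _ _ Dt H ι P hN hK hdisc hHN hHp hLt hP hc hPinf ↦
      indexLowerBoundAt_corner_of_certificates hGZ hKo hmod hrec hD36 hChaL W p N K Dt H ι P hX hp5 hN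
        hK hdisc hHN hLt hP hPinf (hZ W p N K Dt H.β ι hX hns h57 hv hnr hN hK hdisc hHN hHp H.dvd_sq_sub hc))
    ?_
  intro K _ _ Wd _ _ Cd hK hHN hLt hWd hnsd
  have hD0 : (NumberField.discr K : ℚ) ≠ 0 := by exact_mod_cast NumberField.discr_ne_zero K
  haveI : (W.quadraticTwist (NumberField.discr K : ℚ)).IsElliptic := W.isElliptic_quadraticTwist hD0
  have hrd : Wd.analyticRank = 0 := by
    rw [← hWd, analyticRank_smul]
    exact analyticRank_eq_zero_of_entireLFunction_one_ne_zero _ hLt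
  have hXa : ClassX11a Wd p := classX11a_twist_of_not_ram W p hX hnr K hK hHN Cd hWd hrd
  have hpN : p ∣ W.conductorNorm ℤ := dvd_conductorNorm_of_mult hX.2.2.1
  have hsq := isSquare_discr_padic_of_heegner K hK hHN p hpN
  have hvd : p ∣ padicValInt p Wd.minimalDiscriminantInt := by
    rw [padicValInt_minimalDiscriminantInt_twist_eq W p hD0 hsq Cd hWd]
    exact hv
  exact hleafU Wd hXa hnsd hvd

end Summit.BirchSwinnertonDyer.Rank1Residual.X11b

end
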